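import Summits.ValiantsHypothesis.ValiantsHypothesis.Theorems.SymmetroidPencilBasics

/-!
# Route «KPlusLogSqLaw», crux `WeakLifting` (stmt-ValiantsHypothesis-19561) — α register / Lift line:
# RANK UNFOLDING of a lacunary pencil with an INVERTIBLE pivot letter (Sylvester's determinant identity)

HONEST FRAMING.  Helper file (`--supports stmt-ValiantsHypothesis-19561 --as helper`), seat val-sym-lift-p2 (g12), cell
`pub-symmetroid`, 2026-08-28.  Pure linear algebra over `ℝ`; nothing here bounds a root count; nothing bears on `WeakLifting`,
`TropicalB`, Conjecture B, the Door-A registers, `MatrixDescartes` (stmt-ValiantsHypothesis-18050) or VP ≠ VNP.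

WHAT IS PROVED.  Let `F(X) = ∑ₖ X^{dₖ} • Mₖ Mₖᵀ − X^e • N` be a real `m × m` lacunary pencil whose «pivot» letter `N` is
INVERTIBLE (`N * N' = 1`) and whose other letters are Gram matrices `Mₖ Mₖᵀ` (every positive semidefinite real matrix is one,
`exists_mul_transpose_of_posSemidef`).  Stack the factors into `V : Fin m × (Fin m × Fin K)`, `V i (j,k) = Mₖ i j`, and put
`C′ = Vᵀ N' V` (an `(m·K) × (m·K)` real matrix, symmetric when `N` is, positive semidefinite when `N ≻ 0`).  Then for every
`x > 0`
        `det F(x) = 0  ↔  det ( ∑ₖ x^{cₖ} • Eₖ − x^D • C′ ) = 0`,        `cₖ + dₖ = D + e`,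
where `Eₖ` is the diagonal `0/1` projector onto the `k`-th copy of `Fin m` (`det_eq_zero_iff_det_unfold_eq_zero`).  Mechanism:
`F(x) = V E(x) Vᵀ − x^e N` with `E(x) = diag(x^{dₖ})`, Sylvester's identity `det(1 − A B) = det(1 − B A)`
(Mathlib `Matrix.det_one_sub_mul_comm`) moves the `x`-dependence onto the diagonal: `det(x^e·1 − E(x) C′)`, and
`E(x) · (∑ₖ x^{cₖ} Eₖ − x^D C′) = x^D (x^e·1 − E(x) C′)`.  Consequences in the census currency (same POSITIVE-root finsets
of the two determinant polynomials: `posRoots_pencil_eq_posRoots_unfold`; the PSD-letters / definite-pivot wrapper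
`exists_psd_unfold_of_posDef`).

WHY (read-me for the α register and the Lift line).  The UNFOLDED pencil is «monomial diagonal minus a constant matrix»:
`t ↦ det(diag(e^{cₖ t}) − e^{Dt} C′)`, i.e. exactly the frame `det(E(t) − C)` of the lineage's α-register memos (val-sym-lift-p2
g9–g11; lift-p1/lift-p3: `e^{tE} − J₀`), with `C = C′` POSITIVE SEMIDEFINITE precisely when the pivot letter is DEFINITE
(`−N ≺ 0`).  So: (i) the lineage's CONJECTURE R0 («`det(E(t) − A)`, `A ≻ 0`, has at most `size` real zeros», g10 memo §1) is the
same statement as the RANK LAW «`Z₊(∑ X^{dₖ}Pₖ − X^e N) ≤ ∑ rank Pₖ` for PSD `Pₖ` and `N ≻ 0`» on the DEFINITE-PIVOT sub-sector of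
the Lift line's one-indefinite normal form (`Cruxes/MatrixDescartes/Lines/Lift.lean`, `X^e J + ∑ X^{dₖ}Pₖ`); (ii) with an
INDEFINITE invertible pivot the unfolded `C′` is indefinite — the general one-indefinite form, crux-equivalent by the tree's PSD lift
(`…MatrixDescartesOneIndefiniteIff`), so no linear law can hold for «monomial diagonal minus an ARBITRARY symmetric C».
Neither (i) nor (ii) is asserted here; only the identity is proved.

[folklore] Sylvester 1851 / Weinstein–Aronszajn determinant identity; Gram factorisation of PSD matrices (spectral theorem).
-/

-- `Summit.ValiantsHypothesis.ValiantsHypothesis.…` repeats a component by the D-0017 layout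
-- (single-conjunct summit), which the `dupNamespace` linter flags; the name is mandated.
set_option linter.dupNamespace false
set_option autoImplicit false

namespace Summit.ValiantsHypothesis.ValiantsHypothesis.Theorems.KPlusLogSqLaw.DefinitePivot

open Matrix Polynomial Finset
open scoped BigOperators

/-! ## 1. Gram factorisation of a positive semidefinite real matrix -/

section PSD

variable {n : Type*} [Fintype n] [DecidableEq n]

/-- **A real positive semidefinite matrix is a Gram matrix**: `P = M Mᵀ` (`M = U · diag(√λ)` from the spectral
theorem; the tree's `Census.exists_mul_transpose_of_posDef` without the invertibility clause). [folklore] -/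
theorem exists_mul_transpose_of_posSemidef {P : Matrix n n ℝ} (hP : P.PosSemidef) :
    ∃ M : Matrix n n ℝ, P = M * Mᵀ := by
  -- adapted from Theorems/LacunarySymmetroidMatrixDescartesCensusGardingRows.lean (exists_mul_transpose_of_posDef)
  have hA : P.IsHermitian := hP.1
  set U : Matrix n n ℝ := (hA.eigenvectorUnitary : Matrix n n ℝ) with hU
  set D : Matrix n n ℝ := diagonal (fun i => Real.sqrt (hA.eigenvalues i)) with hD
  refine ⟨U * D, ?_⟩
  have hDD : D * Dᵀ = diagonal hA.eigenvalues := by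
    rw [hD, diagonal_transpose, diagonal_mul_diagonal]
    congr 1
    funext i
    exact Real.mul_self_sqrt (hP.eigenvalues_nonneg i)
  have hspec := hA.spectral_theorem
  rw [Unitary.conjStarAlgAut_apply, Matrix.star_eq_conjTranspose,
    conjTranspose_eq_transpose_of_trivial] at hspec
  have hdiag : diagonal (RCLike.ofReal ∘ hA.eigenvalues : n → ℝ) = diagonal hA.eigenvalues := by
    congr 1
  rw [hdiag] at hspec
  calc P = U * diagonal hA.eigenvalues * Uᵀ := hspec
    _ = U * (D * Dᵀ) * Uᵀ := by rw [hDD]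
    _ = U * D * (U * D)ᵀ := by rw [transpose_mul, Matrix.mul_assoc, Matrix.mul_assoc, Matrix.mul_assoc]

end PSD

/-! ## 2. The stacked factor matrix and the unfolding identity at a point -/

section Unfold

variable {m K : ℕ}

/-- **Stacking Gram factors**: `∑ₖ wₖ • Mₖ Mₖᵀ = V · diag(w) · Vᵀ` with `V i (j,k) = Mₖ i j` and the weight `w_k` repeated on
the `k`-th copy of `Fin m`. [folklore] -/
theorem sum_smul_mul_transpose_eq (M : Fin K → Matrix (Fin m) (Fin m) ℝ) (w : Fin K → ℝ) :
    (∑ k, w k • (M k * (M k)ᵀ)) =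
      (Matrix.of fun (i : Fin m) (jk : Fin m × Fin K) => M jk.2 i jk.1) *
        Matrix.diagonal (fun jk : Fin m × Fin K => w jk.2) *
        (Matrix.of fun (i : Fin m) (jk : Fin m × Fin K) => M jk.2 i jk.1)ᵀ := by
  ext i j
  rw [Matrix.mul_apply]
  simp only [Matrix.mul_diagonal]
  simp only [Matrix.of_apply, Matrix.transpose_apply, Matrix.sum_apply, Matrix.smul_apply, smul_eq_mul,
    Matrix.mul_apply]
  rw [Fintype.sum_prod_type, Finset.sum_comm]
  refine Finset.sum_congr rfl fun k _ => ?_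
  rw [Finset.mul_sum]
  refine Finset.sum_congr rfl fun a _ => ?_
  ring

/-- the block projectors with monomial weights sum to a diagonal matrix: `∑ₖ wₖ • Eₖ = diag(w_{k(jk)})`. [folklore] -/
theorem sum_smul_blockProj_eq_diagonal (w : Fin K → ℝ) :
    (∑ k, w k • Matrix.diagonal (fun jk : Fin m × Fin K => if jk.2 = k then (1 : ℝ) else 0)) =
      Matrix.diagonal (fun jk : Fin m × Fin K => w jk.2) := by
  ext a b
  simp only [Matrix.sum_apply, Matrix.smul_apply, Matrix.diagonal_apply, smul_eq_mul, mul_ite, mul_one, mul_zero]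
  by_cases hab : a = b
  · simp only [hab, if_true]
    rw [Finset.sum_ite_eq]
    simp
  · simp [hab]

/-- scaling lemma behind Sylvester's identity: for `y ≠ 0`, `det(y·1 − A B) = 0 ↔ det(y·1 − B A) = 0`
(rectangular `A`, `B`). [folklore] -/
theorem det_smul_one_sub_mul_eq_zero_iff {p q : Type*} [Fintype p] [Fintype q] [DecidableEq p] [DecidableEq q]
    (A : Matrix p q ℝ) (B : Matrix q p ℝ) {y : ℝ} (hy : y ≠ 0) :
    (y • (1 : Matrix p p ℝ) - A * B).det = 0 ↔ (y • (1 : Matrix q q ℝ) - B * A).det = 0 := by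
  have h1 : y • (1 : Matrix p p ℝ) - A * B = y • ((1 : Matrix p p ℝ) - (y⁻¹ • A) * B) := by
    rw [smul_sub, Matrix.smul_mul, smul_smul, mul_inv_cancel₀ hy, one_smul]
  have h2 : y • (1 : Matrix q q ℝ) - B * A = y • ((1 : Matrix q q ℝ) - B * (y⁻¹ • A)) := by
    rw [smul_sub, Matrix.mul_smul, smul_smul, mul_inv_cancel₀ hy, one_smul]
  rw [h1, h2, Matrix.det_smul, Matrix.det_smul, Matrix.det_one_sub_mul_comm]
  have hp : (y ^ Fintype.card p) ≠ 0 := pow_ne_zero _ hy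
  have hq : (y ^ Fintype.card q) ≠ 0 := pow_ne_zero _ hy
  constructor
  · intro h
    rcases mul_eq_zero.1 h with h | h
    · exact absurd h hp
    · exact mul_eq_zero_of_right _ h
  · intro h
    rcases mul_eq_zero.1 h with h | h
    · exact absurd h hq
    · exact mul_eq_zero_of_right _ h

/-- **THE UNFOLDING IDENTITY AT A POINT.**  `F(x) = ∑ₖ x^{dₖ} Mₖ Mₖᵀ − x^e N` with `N N' = 1`; `V i (j,k) = Mₖ i j`,
`C′ = Vᵀ N' V`, `Eₖ` the diagonal projector onto the `k`-th block, exponents `cₖ + dₖ = D + e`.  For `x > 0`: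
`det F(x) = 0 ↔ det(∑ₖ x^{cₖ} Eₖ − x^D C′) = 0`. [folklore] -/
theorem det_eq_zero_iff_det_unfold_eq_zero (M : Fin K → Matrix (Fin m) (Fin m) ℝ)
    (N N' : Matrix (Fin m) (Fin m) ℝ) (hN : N * N' = 1) (d c : Fin K → ℕ) (e D : ℕ)
    (hc : ∀ k, c k + d k = D + e) {x : ℝ} (hx : 0 < x) :
    (∑ k, x ^ d k • (M k * (M k)ᵀ) - x ^ e • N).det = 0 ↔
      (∑ k, x ^ c k • Matrix.diagonal (fun jk : Fin m × Fin K => if jk.2 = k then (1 : ℝ) else 0) -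
        x ^ D • ((Matrix.of fun (i : Fin m) (jk : Fin m × Fin K) => M jk.2 i jk.1)ᵀ * N' *
          (Matrix.of fun (i : Fin m) (jk : Fin m × Fin K) => M jk.2 i jk.1))).det = 0 := by
  set V : Matrix (Fin m) (Fin m × Fin K) ℝ := Matrix.of fun (i : Fin m) (jk : Fin m × Fin K) => M jk.2 i jk.1
    with hV
  set E : Matrix (Fin m × Fin K) (Fin m × Fin K) ℝ := Matrix.diagonal (fun jk : Fin m × Fin K => x ^ d jk.2) with hE
  have hxe : x ^ e ≠ 0 := pow_ne_zero _ hx.ne'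
  have hxD : x ^ D ≠ 0 := pow_ne_zero _ hx.ne'
  -- (1) F(x) = V E Vᵀ − x^e N = −(N (x^e·1 − (N' V)(E Vᵀ)))
  have hF : (∑ k, x ^ d k • (M k * (M k)ᵀ) - x ^ e • N) =
      -(N * (x ^ e • (1 : Matrix (Fin m) (Fin m) ℝ) - (N' * V) * (E * Vᵀ))) := by
    rw [sum_smul_mul_transpose_eq M (fun k => x ^ d k), ← hV, ← hE, Matrix.mul_sub, Matrix.mul_smul, Matrix.mul_one,
      ← Matrix.mul_assoc, ← Matrix.mul_assoc, ← Matrix.mul_assoc, hN, Matrix.one_mul, neg_sub, Matrix.mul_assoc]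
  -- (2) E · G(x) = x^D · (x^e·1 − E C′)
  have hEsum : E * (∑ k, x ^ c k • Matrix.diagonal (fun jk : Fin m × Fin K => if jk.2 = k then (1 : ℝ) else 0)) =
      x ^ D • (x ^ e • (1 : Matrix (Fin m × Fin K) (Fin m × Fin K) ℝ)) := by
    rw [sum_smul_blockProj_eq_diagonal, hE, Matrix.diagonal_mul_diagonal, smul_smul, ← Matrix.diagonal_one,
      ← Matrix.diagonal_smul]
    congr 1
    funext jk
    simp only [Pi.smul_apply, smul_eq_mul, mul_one]
    rw [← pow_add, ← pow_add, add_comm (d jk.2), hc jk.2]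
  have hEG : E * (∑ k, x ^ c k • Matrix.diagonal (fun jk : Fin m × Fin K => if jk.2 = k then (1 : ℝ) else 0) -
      x ^ D • (Vᵀ * N' * V)) = x ^ D • (x ^ e • (1 : Matrix _ _ ℝ) - (E * Vᵀ) * (N' * V)) := by
    rw [Matrix.mul_sub, hEsum, Matrix.mul_smul, smul_sub]
    simp only [Matrix.mul_assoc]
  have hdetE : E.det ≠ 0 := by
    rw [hE, Matrix.det_diagonal]
    exact Finset.prod_ne_zero_iff.2 fun jk _ => pow_ne_zero _ hx.ne'
  -- assemble
  rw [hF, Matrix.det_neg, Matrix.det_mul]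
  have hNdet : N.det ≠ 0 := by
    have h := congrArg Matrix.det hN
    rw [Matrix.det_mul, Matrix.det_one] at h
    exact left_ne_zero_of_mul_eq_one h
  rw [mul_eq_zero, mul_eq_zero, or_iff_right (pow_ne_zero _ (by norm_num : (-1 : ℝ) ≠ 0)), or_iff_right hNdet,
    det_smul_one_sub_mul_eq_zero_iff (N' * V) (E * Vᵀ) hxe]
  -- right side: det G = 0 ↔ det (x^e·1 − (E Vᵀ)(N' V)) = 0 via det E · det G = (x^D)^card · det(...)
  have key : E.det * (∑ k, x ^ c k • Matrix.diagonal (fun jk : Fin m × Fin K => if jk.2 = k then (1 : ℝ) else 0) -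
      x ^ D • (Vᵀ * N' * V)).det = (x ^ D) ^ Fintype.card (Fin m × Fin K) *
        (x ^ e • (1 : Matrix _ _ ℝ) - (E * Vᵀ) * (N' * V)).det := by
    rw [← Matrix.det_mul, hEG, Matrix.det_smul]
  constructor
  · intro h
    have h2 : E.det * (∑ k, x ^ c k • Matrix.diagonal (fun jk : Fin m × Fin K => if jk.2 = k then (1 : ℝ) else 0) -
        x ^ D • (Vᵀ * N' * V)).det = 0 := by
      rw [key, h, mul_zero]
    rcases mul_eq_zero.1 h2 with h3 | h3
    · exact absurd h3 hdetE
    · exact h3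
  · intro h
    have h2 : (x ^ D) ^ Fintype.card (Fin m × Fin K) * (x ^ e • (1 : Matrix _ _ ℝ) - (E * Vᵀ) * (N' * V)).det = 0 := by
      rw [← key, h, mul_zero]
    rcases mul_eq_zero.1 h2 with h3 | h3
    · exact absurd h3 (pow_ne_zero _ hxD)
    · exact h3

/-! ## 3. Census currency: the two determinant polynomials have the same positive roots -/

/-- evaluating `det (∑ X^{aₗ} • Sₗ − X^b • T)` at a real point (any finite index type; `det` commutes with the evaluation
ring homomorphism). [folklore] -/
theorem eval_det_pencil_sub {ι n : Type*} [Fintype ι] [Fintype n] [DecidableEq n]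
    (S : ι → Matrix n n ℝ) (a : ι → ℕ) (T : Matrix n n ℝ) (b : ℕ) (t : ℝ) :
    ((∑ l, (X : ℝ[X]) ^ a l • (S l).map C - (X : ℝ[X]) ^ b • T.map C).det).eval t
      = (∑ l, t ^ a l • S l - t ^ b • T).det := by
  have h := RingHom.map_det (Polynomial.evalRingHom t)
    (∑ l, (X : ℝ[X]) ^ a l • (S l).map C - (X : ℝ[X]) ^ b • T.map C)
  rw [Polynomial.coe_evalRingHom] at h
  rw [h]
  have e1 : (RingHom.mapMatrix (m := n) (Polynomial.evalRingHom t))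
      (∑ l, (X : ℝ[X]) ^ a l • (S l).map C - (X : ℝ[X]) ^ b • T.map C) = ∑ l, t ^ a l • S l - t ^ b • T := by
    ext i j
    simp only [RingHom.mapMatrix_apply, Matrix.map_apply, Matrix.sub_apply, Matrix.sum_apply, Matrix.smul_apply,
      smul_eq_mul, Polynomial.coe_evalRingHom, Polynomial.eval_sub, Polynomial.eval_finsetSum, Polynomial.eval_mul,
      Polynomial.eval_pow, Polynomial.eval_X, Polynomial.eval_C]
  rw [e1]

/-- two real polynomials whose evaluations vanish at the same POSITIVE points have the same finset of positive roots
(if one is the zero polynomial so is the other: infinitely many roots). [folklore] -/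
theorem posRoots_eq_of_forall_eval_eq_zero_iff (p q : ℝ[X])
    (h : ∀ x : ℝ, 0 < x → (p.eval x = 0 ↔ q.eval x = 0)) :
    p.roots.toFinset.filter (fun t => 0 < t) = q.roots.toFinset.filter (fun t => 0 < t) := by
  have key : ∀ p q : ℝ[X], (∀ x : ℝ, 0 < x → (p.eval x = 0 ↔ q.eval x = 0)) → p = 0 → q = 0 := by
    intro p q h hp
    apply Polynomial.eq_zero_of_infinite_isRoot
    refine Set.Infinite.mono (s := Set.Ioi (0 : ℝ)) (fun x hx => ?_) (Set.Ioi_infinite 0)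
    exact (h x hx).1 (by rw [hp, eval_zero])
  by_cases hp : p = 0
  · have hq : q = 0 := key p q h hp
    rw [hp, hq]
  · have hq : q ≠ 0 := fun hq => hp (key q p (fun x hx => (h x hx).symm) hq)
    ext t
    simp only [Finset.mem_filter, Multiset.mem_toFinset, Polynomial.mem_roots hp, Polynomial.mem_roots hq,
      Polynomial.IsRoot.def]
    constructor
    · rintro ⟨h1, h2⟩
      exact ⟨(h t h2).1 h1, h2⟩
    · rintro ⟨h1, h2⟩
      exact ⟨(h t h2).2 h1, h2⟩

/-- **UNFOLDING IN CENSUS CURRENCY (invertible pivot).**  The lacunary pencil `∑ₖ X^{dₖ} • MₖMₖᵀ − X^e • N` (`N N' = 1`) and its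
unfolding `∑ₖ X^{cₖ} • Eₖ − X^D • (Vᵀ N' V)` (size `Fin m × Fin K`, `cₖ + dₖ = D + e`) have THE SAME finset of positive roots of their
determinants. [folklore] -/
theorem posRoots_pencil_eq_posRoots_unfold (M : Fin K → Matrix (Fin m) (Fin m) ℝ)
    (N N' : Matrix (Fin m) (Fin m) ℝ) (hN : N * N' = 1) (d c : Fin K → ℕ) (e D : ℕ)
    (hc : ∀ k, c k + d k = D + e) :
    ((∑ k, (X : ℝ[X]) ^ d k • (M k * (M k)ᵀ).map C - (X : ℝ[X]) ^ e • N.map C).det.roots.toFinset.filter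
        (fun t => 0 < t)) =
      ((∑ k, (X : ℝ[X]) ^ c k •
            (Matrix.diagonal (fun jk : Fin m × Fin K => if jk.2 = k then (1 : ℝ) else 0)).map C -
          (X : ℝ[X]) ^ D • (((Matrix.of fun (i : Fin m) (jk : Fin m × Fin K) => M jk.2 i jk.1)ᵀ * N' *
            (Matrix.of fun (i : Fin m) (jk : Fin m × Fin K) => M jk.2 i jk.1))).map C).det.roots.toFinset.filter
        (fun t => 0 < t)) := by
  refine posRoots_eq_of_forall_eval_eq_zero_iff _ _ fun x hx => ?_
  rw [eval_det_pencil_sub, eval_det_pencil_sub]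
  exact det_eq_zero_iff_det_unfold_eq_zero M N N' hN d c e D hc hx

/-- **UNFOLDING OF THE DEFINITE-PIVOT SECTOR (PSD letters, `N ≻ 0`).**  For positive semidefinite `Pₖ` and positive definite `N`
there is a positive semidefinite `C′` of size `Fin m × Fin K` (namely `Vᵀ N⁻¹ V` for Gram factors of the `Pₖ`) such that
`∑ₖ X^{dₖ} • Pₖ − X^e • N` and the «monomial diagonal minus constant PSD» pencil `∑ₖ X^{cₖ} • Eₖ − X^D • C′` have the same
positive roots of their determinants (`cₖ + dₖ = D + e`).  This is the bridge «Lift-line definite pivot ⟷ α-register frame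
`det(E(t) − A)`, `A ⪰ 0`»; no root count is bounded here. [folklore] -/
theorem exists_psd_unfold_of_posDef (P : Fin K → Matrix (Fin m) (Fin m) ℝ) (hP : ∀ k, (P k).PosSemidef)
    (N : Matrix (Fin m) (Fin m) ℝ) (hN : N.PosDef) (d c : Fin K → ℕ) (e D : ℕ) (hc : ∀ k, c k + d k = D + e) :
    ∃ C' : Matrix (Fin m × Fin K) (Fin m × Fin K) ℝ, C'.PosSemidef ∧
      ((∑ k, (X : ℝ[X]) ^ d k • (P k).map C - (X : ℝ[X]) ^ e • N.map C).det.roots.toFinset.filter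
          (fun t => 0 < t)) =
        ((∑ k, (X : ℝ[X]) ^ c k •
              (Matrix.diagonal (fun jk : Fin m × Fin K => if jk.2 = k then (1 : ℝ) else 0)).map C -
            (X : ℝ[X]) ^ D • C'.map C).det.roots.toFinset.filter (fun t => 0 < t)) := by
  classical
  choose M hM using fun k => exists_mul_transpose_of_posSemidef (hP k)
  have hNunit : IsUnit N.det := isUnit_iff_ne_zero.2 hN.det_pos.ne'
  have hNN : N * N⁻¹ = 1 := Matrix.mul_nonsing_inv N hNunit
  set V : Matrix (Fin m) (Fin m × Fin K) ℝ := Matrix.of fun (i : Fin m) (jk : Fin m × Fin K) => M jk.2 i jk.1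
    with hV
  refine ⟨Vᵀ * N⁻¹ * V, ?_, ?_⟩
  · have h := hN.inv.posSemidef.conjTranspose_mul_mul_same V
    rwa [conjTranspose_eq_transpose_of_trivial] at h
  · rw [show (∑ k, (X : ℝ[X]) ^ d k • (P k).map C) = ∑ k, (X : ℝ[X]) ^ d k • (M k * (M k)ᵀ).map C from
      Finset.sum_congr rfl fun k _ => by rw [← hM k]]
    exact posRoots_pencil_eq_posRoots_unfold M N N⁻¹ hNN d c e D hc

/-- bookkeeping: the unfolded pencil has size `m·K`. [folklore] -/
theorem card_unfold_index (m K : ℕ) : Fintype.card (Fin m × Fin K) = m * K := by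
  simp

end Unfold

end Summit.ValiantsHypothesis.ValiantsHypothesis.Theorems.KPlusLogSqLaw.DefinitePivot
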